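import Summits.QuantumFields.YangMills.Theorems.OneCertifiedCubeFiniteSizeCriterion
import Summits.QuantumFields.YangMills.Theorems.LangevinControlUVOSLegsFromFemtoAndGapDefs
import Summits.QuantumFields.YangMills.Theses.BalabanLadder
import Summits.QuantumFields.YangMills.Theorems.BalabanLadderIRStubShellRung
import Summits.QuantumFields.YangMills.Theorems.BalabanLadderIRStrongCouplingTV
import Summits.QuantumFields.YangMills.Theorems.BalabanLadderIROuterToTV

/-!
# BC3 line for crux `IR` (stmt-QuantumFields-19354) of route-QuantumFields-BalabanLadder — line L2″, skeleton **v10 =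
v9 «OUTER-shell tempering» with the engine stub DISCHARGED BY NAME** (`exact OuterEngine.outerToTV_proved`, module
`Theorems.BalabanLadderIROuterToTV` in the tree); ONE open stub: `stub_outerCert : IROuterCertificate`.  (ym-beyond seat
P2 g18, route owner, 2026-08-26; to be registered by the courier after the three `Outer…` modules land.)  v9 =
`IR_birth_cell_v9.lean` 9946e817099fc2da superseded the registered v8 (`IR_birth_cell_v8.lean` 2c85f0ed17c39195).

**WHY v9 (owner's third audit, STATUS «LOCALITY DEFECT in clause (i)» 2026-08-26 ≈08:3xZ).**  Clause (i) of v6–v8's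
`CellTemperedCond` asked for centre-cell mixing `≤ ε` for every pair of data that is «equal or BOTH GOOD» on EVERY
cell of window+shell off the region `Y` — including the cells ADJACENT to the centre (`Y = {0}`).  The Wilson kernel
of the centre cell reads exactly the adjacent cells, and at weak coupling its law is TV-far from the law under a
frame-inequivalent adjacent datum (an open Wilson line through the centre cell between two sites of a neighbour `c`
concentrates on the datum's holonomy inside `c`; a datum gauge-rotated on a patch of `c` moves that target), while
clause (ii) forces every `Good c` to carry probability `≥ 1 − δ` under both kernels.  So (i)+(ii) were jointly
unsatisfiable at weak coupling for EVERY good family, independently of any mass-gap input: the stub `stub_cellCert`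
of v8 was dead as a target (not formally refuted: its negation needs an `NT` witness).  The ENGINE never used that
freedom: the landed `Engine.tempered_recursion_step` (Theorems/BalabanLadderIRTemperedRecursionStep.lean) invokes the
tempered hypothesis only on pairs from `Rgood` — pinned to one datum off the volume within cell radius `2n+1`, good on
the shell cells inside the volume — i.e. pairs that AGREE on every cell of the radius-`2n` window off `Λ₀` and are
«equal or both good» only on the OUTER SHELL (cell radius exactly `2n+1`).  v9 types exactly that:

* `OuterTemperedCond ρ β b n ε δ` — v8's condition with clause (i♭): for every sub-region `Y ⊆ window` containing
  the central cell and every pair `σ, σ'` that on each cell of window+shell off `Y` is «EQUAL, or — on a cell of the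
  OUTER SHELL `windowCellsPlus n ∖ windowCells n` only — BOTH GOOD», the centre-cell expectations under the kernel
  of `Y` differ by `≤ ε`; clause (ii) (per-cell rarity `≤ δ` under every kernel containing the cell, every datum),
  measurability and `DependsOn (cellEdges w c)` VERBATIM.  `CellTemperedCond → OuterTemperedCond`
  (`outer_of_cellTempered`, proved below): v9's certificate is a WEAKENING of v8's, so every idea filed against v8
  applies; with `Good ≡ univ` it is 8895's `TVCondAt` plus a vacuous (ii); for `Y = {0}` it is trivially true.
  Content: decay of the OUTER-shell influence across `2n` cells of good-or-frozen data = complete analyticity at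
  scale `ℓ`, tempered à la Bassalygo–Dobrushin on the far layer only.
* `TVCondAt` (8895's hypothesis, verbatim, unchanged), `OuterToTV` (THE ENGINE, re-proved under the weakened
  hypothesis in the owner's modules `Theorems.BalabanLadderIROuterRecursionStep` / `…IROuterRecursion` /
  `…IROuterToTV`, namespace `…CellTempered.OuterEngine`, farm rc 0 / 0 sorry — ≈ 40 changed lines against the landed
  `Engine` chain: the recursion's pair hypothesis gains the conjunct `¬ ∀ i, |cell v i − x i| ≤ 2n` in its good
  branch, supplied at the single use site from `v ∈ Λ, v ∉ Λ₀`; `hFS_of_mix_outer` reads it off clause (i♭);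
  `Engine.hBad_of_rare`, the frame geometry and `Engine.exists_pow_mul_le` are reused BY NAME), `OuterCriterion` /
  `outerCriterion_of` (DERIVED from `OuterToTV` and the tree's `FiniteSizeCriterion_proof`, real proof),
  `OuterCertificate r a`, `gapInUnits_of_outer` (PROVED seam), `IRCal` (IR's body verbatim), `IROuterCertificate`
  (THE CRUX in certificate form), `irCal_of_outer`, `IR_of` (closed form, concludes `BalabanLadder.IR` BY NAME).
STUBS: `stub_outerToTV : OuterToTV` (engine; DISCHARGED BY NAME in this v10) · `stub_outerCert : IROuterCertificate` (THE CRUX) · `stub_outerRung` (BC5 format rung at strong coupling,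
`Good ≡ univ`, DISCHARGED BY NAME from `Tempered.tv_strong_coupling_all`, module `BalabanLadderIRStrongCouplingTV`;
not used by `IR_of`).  `IR_of := irCal_of_outer (outerCriterion_of stub_outerToTV) stub_outerCert` consumes exactly
{`stub_outerToTV`, `stub_outerCert`}.
-/

set_option autoImplicit false

noncomputable section

open Filter Topology MeasureTheory
open Literature.MathematicalPhysics.QuantumFieldTheory Literature.MathematicalPhysics.QuantumLattice
open Summit.QuantumFields.YangMills.Cruxes.OSLegsFromFemtoAndGap.DlrCollarTransfer (GapInUnits LowerBounds)
open Summit.QuantumFields.YangMills.Cruxes.IR.Tempered (cellEdges windowCells regionEdges)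
open Summit.QuantumFields.YangMills.Cruxes.IR.ShellTempered (windowCellsPlus)

namespace Summit.QuantumFields.YangMills.Cruxes.IR.CellTempered

/-! ## §1 The outer-tempered finite-size condition, v8's condition (for comparison) and 8895's hypothesis -/

section Defs

variable {G : Type} [Group G] [TopologicalSpace G] [IsTopologicalGroup G] [CompactSpace G]
  [MeasurableSpace G] [BorelSpace G]

/-- **Outer-tempered finite-size condition (v9)** at `(ρ, β, b, n, ε, δ)`: per mesh-`b` frame a family of per-cell
good events (measurable, determined by the cell's edges) with (i♭) 8895-shaped sub-region mixing `≤ ε` for pairs of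
data that AGREE on every cell of window+shell off `Y` except possibly on OUTER-SHELL cells where both are good, and
(ii) per-cell rarity `≤ δ` under every kernel containing the cell, every datum. -/
def OuterTemperedCond {N : ℕ} (ρ : G →* Matrix (Fin N) (Fin N) ℂ) (β : ℝ) (b n : ℕ) (ε δ : ℝ) : Prop :=
  ∀ w : Fin 4 → ℤ → ℤ, (∀ i j, w i j + ((b : ℕ) : ℤ) ≤ w i (j + 1) ∧ w i (j + 1) ≤ w i j + 2 * ((b : ℕ) : ℤ)) →
    ∃ Good : (Fin 4 → ℤ) → Set (LGConfig 4 G),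
      (∀ c, MeasurableSet (Good c)) ∧ (∀ c, DependsOn (fun σ : LGConfig 4 G => σ ∈ Good c) ↑(cellEdges w c)) ∧
      (∀ Y : Finset (Fin 4 → ℤ), Y ⊆ windowCells n → (0 : Fin 4 → ℤ) ∈ Y →
        ∀ σ σ' : LGConfig 4 G,
          (∀ c ∈ windowCellsPlus n, c ∉ Y →
            ((∀ e ∈ cellEdges w c, σ e = σ' e) ∨ (c ∉ windowCells n ∧ σ ∈ Good c ∧ σ' ∈ Good c))) →
          ∀ f : LGConfig 4 G → ℝ, IsCylinder f (cellEdges w 0) → Measurable f → (∀ U, 0 ≤ f U ∧ f U ≤ 1) →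
            |(∫ U, f U ∂(ymSpecification ρ β (regionEdges w Y) σ)) -
              ∫ U, f U ∂(ymSpecification ρ β (regionEdges w Y) σ')| ≤ ε) ∧
      (∀ c : Fin 4 → ℤ, ∀ E' : Finset (Literature.MathematicalPhysics.QuantumLattice.ZdEdge 4), cellEdges w c ⊆ E' →
        ∀ ζ : LGConfig 4 G, (ymSpecification ρ β E' ζ) (Good c)ᶜ ≤ ENNReal.ofReal δ)

/-- **v8's cell-tempered condition** (SUPERSEDED — kept only for the comparison `outer_of_cellTempered`): as
`OuterTemperedCond` but with «both good» allowed on EVERY differing cell off `Y`, including the cells adjacent to the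
centre; jointly with (ii) this is unsatisfiable at weak coupling (module docstring). -/
def CellTemperedCond {N : ℕ} (ρ : G →* Matrix (Fin N) (Fin N) ℂ) (β : ℝ) (b n : ℕ) (ε δ : ℝ) : Prop :=
  ∀ w : Fin 4 → ℤ → ℤ, (∀ i j, w i j + ((b : ℕ) : ℤ) ≤ w i (j + 1) ∧ w i (j + 1) ≤ w i j + 2 * ((b : ℕ) : ℤ)) →
    ∃ Good : (Fin 4 → ℤ) → Set (LGConfig 4 G),
      (∀ c, MeasurableSet (Good c)) ∧ (∀ c, DependsOn (fun σ : LGConfig 4 G => σ ∈ Good c) ↑(cellEdges w c)) ∧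
      (∀ Y : Finset (Fin 4 → ℤ), Y ⊆ windowCells n → (0 : Fin 4 → ℤ) ∈ Y →
        ∀ σ σ' : LGConfig 4 G,
          (∀ c ∈ windowCellsPlus n, c ∉ Y → ((∀ e ∈ cellEdges w c, σ e = σ' e) ∨ (σ ∈ Good c ∧ σ' ∈ Good c))) →
          ∀ f : LGConfig 4 G → ℝ, IsCylinder f (cellEdges w 0) → Measurable f → (∀ U, 0 ≤ f U ∧ f U ≤ 1) →
            |(∫ U, f U ∂(ymSpecification ρ β (regionEdges w Y) σ)) -
              ∫ U, f U ∂(ymSpecification ρ β (regionEdges w Y) σ')| ≤ ε) ∧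
      (∀ c : Fin 4 → ℤ, ∀ E' : Finset (Literature.MathematicalPhysics.QuantumLattice.ZdEdge 4), cellEdges w c ⊆ E' →
        ∀ ζ : LGConfig 4 G, (ymSpecification ρ β E' ζ) (Good c)ᶜ ≤ ENNReal.ofReal δ)

/-- **8895's finite-size hypothesis** at `(ρ, β, b, n, ε)` — the hypothesis block of
`Summit.QuantumFields.YangMills.Theses.OneCertifiedCube.FiniteSizeCriterion`, text verbatim. -/
def TVCondAt {N : ℕ} (ρ : G →* Matrix (Fin N) (Fin N) ℂ) (β : ℝ) (b n : ℕ) (ε : ℝ) : Prop :=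
  ∀ w : Fin 4 → ℤ → ℤ, (∀ i j, w i j + ((b : ℕ) : ℤ) ≤ w i (j + 1) ∧ w i (j + 1) ≤ w i j + 2 * ((b : ℕ) : ℤ)) →
    ∀ Y : Finset (Fin 4 → ℤ), Y ⊆ (Fintype.piFinset fun _ : Fin 4 => Finset.Icc (-(2 * ((n : ℕ) : ℤ))) (2 * ((n : ℕ) : ℤ))) →
      (0 : Fin 4 → ℤ) ∈ Y → ∀ η η' : Literature.MathematicalPhysics.QuantumLattice.LGConfig 4 G,
        (∀ e ∈ (Fintype.piFinset fun _ : Fin 4 => Finset.Icc (-(2 * ((n : ℕ) : ℤ))) (2 * ((n : ℕ) : ℤ))).biUnion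
            (fun y : Fin 4 → ℤ => (Fintype.piFinset fun i : Fin 4 => Finset.Ico (w i (y i)) (w i (y i + 1))) ×ˢ
              (Finset.univ : Finset (Fin 4))), η e = η' e) →
        ∀ f : Literature.MathematicalPhysics.QuantumLattice.LGConfig 4 G → ℝ,
          Literature.MathematicalPhysics.QuantumLattice.IsCylinder f
            ((fun y : Fin 4 → ℤ => (Fintype.piFinset fun i : Fin 4 => Finset.Ico (w i (y i)) (w i (y i + 1))) ×ˢ
              (Finset.univ : Finset (Fin 4))) 0) → Measurable f → (∀ U, 0 ≤ f U ∧ f U ≤ 1) →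
          |(∫ U, f U ∂(Literature.MathematicalPhysics.QuantumLattice.ymSpecification ρ β
              (Y.biUnion (fun y : Fin 4 → ℤ => (Fintype.piFinset fun i : Fin 4 => Finset.Ico (w i (y i)) (w i (y i + 1))) ×ˢ
                (Finset.univ : Finset (Fin 4)))) η)) -
            ∫ U, f U ∂(Literature.MathematicalPhysics.QuantumLattice.ymSpecification ρ β
              (Y.biUnion (fun y : Fin 4 → ℤ => (Fintype.piFinset fun i : Fin 4 => Finset.Ico (w i (y i)) (w i (y i + 1))) ×ˢ
                (Finset.univ : Finset (Fin 4)))) η')| ≤ ε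

end Defs

/-- **v9 weakens v8**: every good family for v8's clause (i) serves clause (i♭) (fewer pairs are constrained). -/
theorem outer_of_cellTempered {G : Type} [Group G] [TopologicalSpace G] [IsTopologicalGroup G] [CompactSpace G]
    [MeasurableSpace G] [BorelSpace G] {N : ℕ} (ρ : G →* Matrix (Fin N) (Fin N) ℂ) (β : ℝ) (b n : ℕ) (ε δ : ℝ)
    (h : CellTemperedCond ρ β b n ε δ) : OuterTemperedCond ρ β b n ε δ := by
  intro w hw
  obtain ⟨Good, hGm, hGdep, hmix, hrare⟩ := h w hw
  refine ⟨Good, hGm, hGdep, fun Y hY h0 σ σ' hpair => hmix Y hY h0 σ σ' fun c hc hcY => ?_, hrare⟩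
  rcases hpair c hc hcY with hagree | ⟨_, hg, hg'⟩
  · exact Or.inl hagree
  · exact Or.inr ⟨hg, hg'⟩

/-! ## §2 The engine stub (typed), the criterion DERIVED from it and 8895, the certificate, the PROVED seam -/

/-- **The engine — outer-tempered-to-TV.**  For admissible `(n, ε)` there are a coarser window `n' = J(2n+1)`, an
admissible `ε' = (εM)^J + 4MJδ₀` and a rarity budget `δ₀ = 1/(16·M·J·(M(n')+1)) > 0` such that the outer-tempered
condition with `δ ≤ δ₀` implies 8895's own finite-size hypothesis at `(n', ε')`.  PROVED in the owner's modules
(`OuterEngine.outerToTV_proved`, text = this def unfolded). -/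
def OuterToTV : Prop :=
  ∀ (n : ℕ) (ε : ℝ), 1 ≤ n → 0 ≤ ε → ε * ((((4 * n + 3) ^ 4 - (4 * n + 1) ^ 4 : ℕ)) : ℝ) < 1 →
    ∃ (n' : ℕ) (ε' δ₀ : ℝ), 1 ≤ n' ∧ 0 ≤ ε' ∧ ε' * ((((4 * n' + 3) ^ 4 - (4 * n' + 1) ^ 4 : ℕ)) : ℝ) < 1 ∧ 0 < δ₀ ∧
      ∀ (G : Type) [Group G] [TopologicalSpace G] [IsTopologicalGroup G] [CompactSpace G]
        [MeasurableSpace G] [BorelSpace G] (N : ℕ) (ρ : G →* Matrix (Fin N) (Fin N) ℂ), Continuous ρ →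
        Function.Injective ρ → ∀ (β : ℝ) (b : ℕ), 1 ≤ b → ∀ δ : ℝ, 0 ≤ δ → δ ≤ δ₀ →
          OuterTemperedCond ρ β b n ε δ → TVCondAt ρ β b n' ε'

/-- **Outer-tempered criterion**: admissible `(n, ε)` ⇒ a rarity budget `δ₀`, a rate `κ` and a torus-size factor `s₀`
such that the outer-tempered condition with `δ ≤ δ₀` at cell side `b` gives clustering at rate `κ/b` on all tori of
side `≥ s₀·b`, constants uniform in `β`, `b`, `δ` and the volume. -/
def OuterCriterion : Prop :=
  ∀ (n : ℕ) (ε : ℝ), 1 ≤ n → 0 ≤ ε → ε * ((((4 * n + 3) ^ 4 - (4 * n + 1) ^ 4 : ℕ)) : ℝ) < 1 →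
    ∃ (δ₀ κ : ℝ) (s₀ : ℕ), 0 < δ₀ ∧ 0 < κ ∧ ∀ (G : Type) [Group G] [TopologicalSpace G] [IsTopologicalGroup G]
      [CompactSpace G] [MeasurableSpace G] [BorelSpace G] (N : ℕ) (ρ : G →* Matrix (Fin N) (Fin N) ℂ),
      Continuous ρ → Function.Injective ρ → ∀ A B : LocalGaugeObservable 4 G, ∃ C : ℝ,
        ∀ (β : ℝ) (b : ℕ), 1 ≤ b → ∀ δ : ℝ, 0 ≤ δ → δ ≤ δ₀ → OuterTemperedCond ρ β b n ε δ →
          ∀ S : ℕ, s₀ * b ≤ 2 * S + 1 → ∀ t : ℕ, t ≤ S →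
            |latticeConnectedCorr ρ β (2 * S + 1) A.F B.F t| ≤ C * Real.exp (-(κ * t / b))

/-- **The criterion from the engine and the TREE's `FiniteSizeCriterion_proof` (8895) at `(n', ε')` (real proof).** -/
theorem outerCriterion_of (hA : OuterToTV) : OuterCriterion := by
  intro n ε hn hε hM
  obtain ⟨n', ε', δ₀, hn', hε', hM', hδ₀, hlift⟩ := hA n ε hn hε hM
  obtain ⟨κ, hκ, hwin⟩ :=
    Summit.QuantumFields.YangMills.Theorems.FiniteSizeCriterion_proof n' ε' hn' hε' hM'
  refine ⟨δ₀, κ, 8 * n' + 7, hδ₀, hκ, ?_⟩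
  intro G _ _ _ _ _ _ N ρ hρc hρi A B
  obtain ⟨C, hC⟩ := hwin G N ρ hρc hρi A B
  exact ⟨C, fun β b hb δ hδ hδ' hcond S hS t ht =>
    hC β b hb (hlift G N ρ hρc hρi β b hb δ hδ hδ' hcond) S hS t ht⟩

section Seam

variable {G : Type} [Group G] [TopologicalSpace G] [IsTopologicalGroup G] [CompactSpace G]
  [MeasurableSpace G] [BorelSpace G]

/-- **The outer-tempered calibrated certificate** for `(G, r, a)`: ONE physical cell size `ℓ`, one admissible
`(n, ε)`, and for EVERY rarity budget `δ > 0` a threshold `β₂(δ)` beyond which the outer-tempered condition holds at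
cell side `⌈ℓ / a(β)⌉₊` lattice units. -/
def OuterCertificate (r : LatticeRep G) (a : ℝ → ℝ) : Prop :=
  ∃ ℓ : ℝ, 0 < ℓ ∧ ∃ (n : ℕ) (ε : ℝ), 1 ≤ n ∧ 0 ≤ ε ∧ ε * ((((4 * n + 3) ^ 4 - (4 * n + 1) ^ 4 : ℕ)) : ℝ) < 1 ∧
    ∀ δ : ℝ, 0 < δ → ∃ β₂ : ℝ, ∀ β : ℝ, β₂ ≤ β → OuterTemperedCond r.ρ β ⌈ℓ / a β⌉₊ n ε δ

/-- **Seam (PROVED): `OuterCriterion → OuterCertificate r a → GapInUnits G r a`**, rate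
`c₁ = κ/(2ℓ)` in units `a`, threshold `max β₂(δ₀) β₃` (`a(β) ≤ ℓ` for `β ≥ β₃`), volume threshold
`S₁(β) = s₀·⌈ℓ/a(β)⌉₊`.  Pure arithmetic. -/
theorem gapInUnits_of_outer (hE : OuterCriterion)
    (r : LatticeRep G) (a : ℝ → ℝ) (ha : ∀ β, 0 < a β) (ha0 : Tendsto a atTop (𝓝 0))
    (hC : OuterCertificate r a) : GapInUnits G r a := by
  obtain ⟨ℓ, hℓ, n, ε, hn, hε, hM, hcert⟩ := hC
  obtain ⟨δ₀, κ, s₀, hδ₀, hκ, hF'⟩ := hE n ε hn hε hM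
  have hAB := hF' G r.N r.ρ r.continuous r.injective
  obtain ⟨β₂, hβ₂⟩ := hcert δ₀ hδ₀
  obtain ⟨β₃, hβ₃⟩ := Filter.eventually_atTop.mp (ha0.eventually (eventually_le_nhds hℓ))
  have hc₁ : 0 < κ / (2 * ℓ) := by positivity
  refine ⟨κ / (2 * ℓ), max β₂ β₃, fun β => s₀ * ⌈ℓ / a β⌉₊, hc₁, ?_⟩
  intro A B
  obtain ⟨C, hCb⟩ := hAB A B
  refine ⟨C, fun β hβ S t hS ht => ?_⟩
  have hβ2 : β₂ ≤ β := le_trans (le_max_left _ _) hβ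
  have hβ3 : β₃ ≤ β := le_trans (le_max_right _ _) hβ
  have h1 : a β ≤ ℓ := hβ₃ β hβ3
  have haβ : 0 < a β := ha β
  have hq : 0 < ℓ / a β := div_pos hℓ haβ
  have hb1 : 1 ≤ ⌈ℓ / a β⌉₊ := Nat.one_le_iff_ne_zero.mpr (Nat.pos_iff_ne_zero.mp (Nat.ceil_pos.mpr hq))
  have hble : ((⌈ℓ / a β⌉₊ : ℕ) : ℝ) ≤ ℓ / a β + 1 := (Nat.ceil_lt_add_one hq.le).le
  have hbpos : (0 : ℝ) < ((⌈ℓ / a β⌉₊ : ℕ) : ℝ) := by exact_mod_cast hb1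
  have hab : ((⌈ℓ / a β⌉₊ : ℕ) : ℝ) * a β ≤ 2 * ℓ := by
    calc ((⌈ℓ / a β⌉₊ : ℕ) : ℝ) * a β ≤ (ℓ / a β + 1) * a β := by gcongr
      _ = ℓ + a β := by field_simp
      _ ≤ 2 * ℓ := by linarith
  have hS' : s₀ * ⌈ℓ / a β⌉₊ ≤ S := hS
  have hside : s₀ * ⌈ℓ / a β⌉₊ ≤ 2 * S + 1 := by omega
  have hbound := hCb β ⌈ℓ / a β⌉₊ hb1 δ₀ hδ₀.le le_rfl (hβ₂ β hβ2) S hside t ht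
  have hC0 : 0 ≤ C := by
    have h0 : 0 ≤ C * Real.exp (-(κ * (t : ℝ) / ((⌈ℓ / a β⌉₊ : ℕ) : ℝ))) := (abs_nonneg _).trans hbound
    exact nonneg_of_mul_nonneg_left h0 (Real.exp_pos _)
  refine hbound.trans ?_
  gcongr
  have ht0 : (0 : ℝ) ≤ (t : ℝ) := by exact_mod_cast Nat.zero_le t
  rw [le_div_iff₀ hbpos]
  calc κ / (2 * ℓ) * a β * (t : ℝ) * ((⌈ℓ / a β⌉₊ : ℕ) : ℝ)
      = κ / (2 * ℓ) * (t : ℝ) * (((⌈ℓ / a β⌉₊ : ℕ) : ℝ) * a β) := by ring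
    _ ≤ κ / (2 * ℓ) * (t : ℝ) * (2 * ℓ) := by gcongr
    _ = κ * (t : ℝ) := by field_simp

end Seam

/-! ## §3 Crux-level child for the spine's `IR` and its composition -/

/-- **IR (verbatim body of `Summit.QuantumFields.YangMills.Theses.BalabanLadder.IR`, item stmt-QuantumFields-19354).** -/
def IRCal : Prop :=
  ∀ (G : Type) [Group G] [TopologicalSpace G] [IsTopologicalGroup G] [CompactSpace G],
    IsCompactSimpleLieGroup G → letI : MeasurableSpace G := borel G; haveI : BorelSpace G := ⟨rfl⟩;
    ∀ (r : LatticeRep G) (a : ℝ → ℝ), (∀ β, 0 < a β) → Tendsto a atTop (𝓝 0) →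
      LowerBounds G r a → GapInUnits G r a

/-- **IR-outer-certificate (child of IR; THE CRUX of R2c in certificate form, v9).**  For every compact simple `G`,
every `r` and every unit map `a` (positive, `→ 0`): IF the lattice theory is non-trivial in units `a`
(`LowerBounds G r a`) THEN at SOME fixed physical cell size `ℓ` and one admissible `(n, ε)` the Wilson specification
is outer-tempered (8895's sub-region shape; good-or-frozen data, goodness consulted on the outer shell only) for
every rarity budget `δ > 0`, for all large `β`.  Simplicity of `G` is load-bearing (false with a U(1) factor:
massless photon, Guth 1980 / Fröhlich–Spencer 1982). -/
def IROuterCertificate : Prop :=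
  ∀ (G : Type) [Group G] [TopologicalSpace G] [IsTopologicalGroup G] [CompactSpace G],
    IsCompactSimpleLieGroup G → letI : MeasurableSpace G := borel G; haveI : BorelSpace G := ⟨rfl⟩;
    ∀ (r : LatticeRep G) (a : ℝ → ℝ), (∀ β, 0 < a β) → Tendsto a atTop (𝓝 0) →
      LowerBounds G r a → OuterCertificate r a

/-- **Composition (real proof): `OuterCriterion → IROuterCertificate → IR`.** -/
theorem irCal_of_outer (hE : OuterCriterion) (hC : IROuterCertificate) : IRCal := by
  intro G _ _ _ _ hG
  letI : MeasurableSpace G := borel G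
  haveI : BorelSpace G := ⟨rfl⟩
  intro r a ha ha0 hlb
  exact gapInUnits_of_outer hE r a ha ha0 (hC G hG r a ha ha0 hlb)

/-! ## BC3 birth skeleton v9 for crux `IR` (stmt-QuantumFields-19354), line L2″ «outer-shell-tempered certificate»:
three REGISTERED stubs + the kernel-checked composition concluding the route decl BY NAME. -/

/-- stub 1 (THE ENGINE — the tree's tempered block recursion under the weakened, outer-shell pair hypothesis).
PROVED in the owner's modules `Theorems.BalabanLadderIROuterRecursionStep` (`OuterEngine.outer_recursion_step`),
`…IROuterRecursion` (`outer_recursion_decay`), `…IROuterToTV` (`hFS_of_mix_outer`, `outerToTV_proved` = `OuterToTV`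
unfolded), all in the tree; discharged by name (definitional unfolding only). -/
theorem stub_outerToTV : OuterToTV := by
  exact Summit.QuantumFields.YangMills.Cruxes.IR.CellTempered.OuterEngine.outerToTV_proved

/-- stub 2 (THE CRUX of R2c in certificate form, v9): every NT-calibrated lattice YM with compact simple `G` admits an
outer-tempered finite-size certificate at one physical cell size. -/
theorem stub_outerCert : IROuterCertificate := by
  sorry

/-- stub 3 = BC5 FORMAT RUNG (strong coupling; `Good ≡ univ`, EVERY sub-region, ALL data), DISCHARGED BY NAME from
`Tempered.tv_strong_coupling_all` (module `BalabanLadderIRStrongCouplingTV`).  Not used by `IR_of`. -/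
theorem stub_outerRung :
    ∀ (G : Type) [Group G] [TopologicalSpace G] [IsTopologicalGroup G] [CompactSpace G]
      [MeasurableSpace G] [BorelSpace G] (N : ℕ) (ρ : G →* Matrix (Fin N) (Fin N) ℂ), Continuous ρ →
      ∀ ε : ℝ, 0 < ε → ∃ β_D : ℝ, 0 < β_D ∧ ∀ β : ℝ, |β| ≤ β_D → ∀ δ : ℝ, 0 ≤ δ →
        OuterTemperedCond ρ β 1 1 ε δ := by
  intro G _ _ _ _ _ _ N ρ hρ ε hε
  obtain ⟨β_D, hβ_D, hTV⟩ :=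
    Summit.QuantumFields.YangMills.Cruxes.IR.Tempered.tv_strong_coupling_all G N ρ hρ ε hε
  refine ⟨β_D, hβ_D, fun β hβ δ _ w hw => ⟨fun _ => Set.univ, fun _ => MeasurableSet.univ, ?_, ?_, ?_⟩⟩
  · intro c σ σ' _
    simp only [Set.mem_univ]
  · intro Y hY h0Y σ σ' _ f hf_cyl hfm hf01
    exact hTV β hβ w hw Y hY h0Y σ σ' f hf_cyl hfm hf01
  · intro c E' _ ζ
    simp only [Set.compl_univ, measure_empty, zero_le]

/-- Composition (CLOSED form, real proof): the spine's crux `IR` BY NAME from the named stubs `stub_outerToTV`,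
`stub_outerCert` through the PROVED `outerCriterion_of` (which invokes the tree's `FiniteSizeCriterion_proof`) and
`irCal_of_outer` (`IRCal` is `IR`'s body verbatim). -/
theorem IR_of : Summit.QuantumFields.YangMills.Theses.BalabanLadder.IR := by
  have h : IRCal := irCal_of_outer (outerCriterion_of stub_outerToTV) stub_outerCert
  delta Summit.QuantumFields.YangMills.Theses.BalabanLadder.IR
  delta Summit.QuantumFields.YangMills.Cruxes.IR.CellTempered.IRCal at h
  exact h

end Summit.QuantumFields.YangMills.Cruxes.IR.CellTempered

end
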